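import Summits.BirchSwinnertonDyer.BirchSwinnertonDyer.Theorems.EisensteinPrimesKatzLineDescentValues
import Mathlib.Algebra.Polynomial.Div
import Mathlib.FieldTheory.IsAlgClosed.Basic
import HarnessLib

/-!
# Root peeling for the `λ`-descent (AN-F₂, route (RIG), structural form): a power series `Ψ` with
# `(1+T)·Ψ′ = a·Ψ` whose product with a non-zero POLYNOMIAL is bounded is itself bounded
# (helper file for crux 2 `GoodLatticeBDPValue`, stmt-BirchSwinnertonDyer-19032, line `halves`, stub 3
# `stub_anDS`/v19 `stub_katzLineDescentQ` (closed, p638329); alternative ODE road; seat `bsd-line-x1-p1-w3` gen 2)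

The ODE road to AN-F₂ (`…KatzLineDescentRelation`/`…ODE` + `…Wronskian`) produces
`L = c·(1+T)^{−a}·Q` in `ℂ_p⟦T⟧` for two frames `Q`, `L` of one `θ_K`; to conclude that `−a ∈ ℤ_p`
(`…BinomialBound`) one needs `(1+T)^{−a}` to have BOUNDED coefficients. With Weierstrass preparation
`Q = P·U` over `𝓞_{ℂ_p}` (`Literature.…Dwork.exists_eq_polynomial_mul_of_norm_le_one`) this is the
statement of this file: if `Ψ ∈ ℂ_p⟦T⟧` satisfies `(1+T)·Ψ′ = a·Ψ` and `Ψ·P` is bounded for a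
polynomial `P ≠ 0`, then `Ψ` is bounded. Proof by peeling the roots of `P` (`ℂ_p` algebraically
closed): a root `α` with `‖α‖ ≥ 1` is harmless (`(T − α)⁻¹` has bounded coefficients); at a root
`α` of the open disc the bounded series `H = Ψ·P` VANISHES — evaluate
`(1+T)(T−α)P₁H′ = H·(a(T−α)P₁ + (1+T)(μP₁ + (T−α)P₁′))` (`P = (T−α)^μ P₁`, `P₁(α) ≠ 0`) at `α` —
so `H = (T − α)·H₁` with `H₁` bounded (tail sums), and `Ψ·(P/(T−α)) = H₁`.

* §1 polynomials as bounded series: `exists_norm_coeff_coe_le`, `hasSum_coeff_coe_polynomial`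
  (value `= Polynomial.eval`);
* §2 `exists_eq_X_sub_C_mul_of_hasSum_zero` (a bounded series vanishing at `‖α‖ < 1` is `(T−α)·H₁`,
  `H₁` bounded by the same constant), `exists_X_sub_C_mul_eq_one_of_one_le_norm` (`‖α‖ ≥ 1`);
* §3 `hasSum_zero_of_ode_mul_polynomial` (the vanishing at an interior root);
* §4 `exists_norm_coeff_le_of_ode_of_mul_polynomial` (the peeling induction).

Pure `p`-adic analysis; no fact, no definition, no `sorry`; nothing about BSD.
References: Cassels 1986 Ch. 4 (Strassmann) and Ch. 6 §5; Washington 1997 §7.1–7.2; Koblitz 1984 Ch. IV §4.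
-/

-- the summit namespace `Summit.BirchSwinnertonDyer.BirchSwinnertonDyer` repeats the problem name by design (D-0017)
set_option linter.dupNamespace false
set_option autoImplicit false

noncomputable section

open scoped Classical Topology

open Filter Finset PowerSeries

namespace Summit.BirchSwinnertonDyer.BirchSwinnertonDyer.Theorems.KatzLineDescent

variable {p : ℕ} [Fact p.Prime]

/-! ## §1 Polynomials as bounded series -/

/-- A polynomial, read in `ℂ_p⟦T⟧`, has bounded coefficients. [folklore] -/
theorem exists_norm_coeff_coe_le (P : Polynomial ℂ_[p]) :
    ∃ B : ℝ, ∀ n, ‖coeff n (P : PowerSeries ℂ_[p])‖ ≤ B := by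
  refine ⟨∑ i ∈ P.support, ‖P.coeff i‖, fun n ↦ ?_⟩
  rw [Polynomial.coeff_coe]
  by_cases hn : n ∈ P.support
  · exact Finset.single_le_sum (f := fun i ↦ ‖P.coeff i‖) (fun i _ ↦ norm_nonneg _) hn
  · rw [Polynomial.notMem_support_iff.mp hn, norm_zero]
    exact Finset.sum_nonneg fun i _ ↦ norm_nonneg _

/-- The value of a polynomial read in `ℂ_p⟦T⟧` is its evaluation (a finite sum). [folklore] -/
theorem hasSum_coeff_coe_polynomial (P : Polynomial ℂ_[p]) (y : ℂ_[p]) :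
    HasSum (fun n ↦ coeff n (P : PowerSeries ℂ_[p]) * y ^ n) (P.eval y) := by
  have h : HasSum (fun n ↦ coeff n (P : PowerSeries ℂ_[p]) * y ^ n)
      (∑ n ∈ P.support, coeff n (P : PowerSeries ℂ_[p]) * y ^ n) :=
    hasSum_sum_of_ne_finset_zero (fun n hn ↦ by
      rw [Polynomial.coeff_coe, Polynomial.notMem_support_iff.mp hn, zero_mul])
  rw [Polynomial.eval_eq_sum, Polynomial.sum_def]
  simpa only [Polynomial.coeff_coe] using h

/-! ## §2 Division by `T − α` -/

/-- **A bounded series vanishing at a point `α` of the open disc is `(T − α)·H₁` with `H₁` bounded**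
(by the same constant): `[T^k]H₁ = Σ_i [T^{i+k+1}]H·α^i` (tail sums). [cite: Cassels1986, Ch. 4 Lemma 2.1]
[cite: Gouvea1993PadicNumbers, §5.6] -/
theorem exists_eq_X_sub_C_mul_of_hasSum_zero {H : PowerSeries ℂ_[p]} {B : ℝ}
    (hH : ∀ n, ‖coeff n H‖ ≤ B) {α : ℂ_[p]} (hα : ‖α‖ < 1)
    (h0 : HasSum (fun n ↦ coeff n H * α ^ n) 0) :
    ∃ H₁ : PowerSeries ℂ_[p], (∀ n, ‖coeff n H₁‖ ≤ B) ∧ H = (X - C α) * H₁ := by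
  -- tails `t k = Σ_i [T^{i+k}]H α^i`
  set t : ℕ → ℂ_[p] := fun k ↦ ∑' i, coeff (i + k) H * α ^ i with ht
  have hbk : ∀ k i, ‖coeff (i + k) H‖ ≤ B := fun k i ↦ hH _
  have hsum : ∀ k, Summable (fun i ↦ coeff (i + k) H * α ^ i) := fun k ↦
    summable_mul_pow (c := fun i ↦ coeff (i + k) H) (hbk k) hα
  have htle : ∀ k, ‖t k‖ ≤ B := fun k ↦ norm_tsum_mul_pow_le (c := fun i ↦ coeff (i + k) H) (hbk k) hα
  -- recursion `t k = [T^k]H + α · t (k+1)`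
  have hrec : ∀ k, t k = coeff k H + α * t (k + 1) := by
    intro k
    simp only [ht]
    rw [(hsum k).tsum_eq_zero_add, pow_zero, mul_one, zero_add, ← (hsum (k + 1)).tsum_mul_left]
    congr 1
    refine tsum_congr fun i ↦ ?_
    rw [pow_succ, show i + 1 + k = i + (k + 1) by ring]; ring
  -- `t 0 = H(α) = 0`
  have ht0 : t 0 = 0 := by
    have : HasSum (fun i ↦ coeff (i + 0) H * α ^ i) (t 0) := (hsum 0).hasSum
    simp only [add_zero] at this
    exact this.unique h0
  refine ⟨PowerSeries.mk fun k ↦ t (k + 1), fun n ↦ by rw [coeff_mk]; exact htle _, ?_⟩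
  ext n
  rcases n with _ | k
  · rw [sub_mul, map_sub, coeff_zero_X_mul, coeff_C_mul, coeff_mk, zero_sub]
    have := hrec 0
    rw [ht0] at this
    linear_combination (-1 : ℂ_[p]) * this
  · rw [sub_mul, map_sub, coeff_succ_X_mul, coeff_C_mul, coeff_mk, coeff_mk]
    linear_combination (-1 : ℂ_[p]) * hrec (k + 1)

/-- **For `‖α‖ ≥ 1`, `T − α` is invertible with a bounded inverse**: `(T − α)·G = 1` for
`G = −Σ α^{−(n+1)} T^n`, `‖[T^n]G‖ ≤ 1`. [folklore] -/
theorem exists_X_sub_C_mul_eq_one_of_one_le_norm {α : ℂ_[p]} (hα : 1 ≤ ‖α‖) :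
    ∃ G : PowerSeries ℂ_[p], (∀ n, ‖coeff n G‖ ≤ 1) ∧ (X - C α) * G = 1 := by
  have hα0 : α ≠ 0 := fun h ↦ by rw [h, norm_zero] at hα; exact absurd hα (by norm_num)
  refine ⟨PowerSeries.mk fun n ↦ -(α ^ (n + 1))⁻¹, fun n ↦ ?_, ?_⟩
  · rw [coeff_mk, norm_neg, norm_inv, norm_pow]
    exact inv_le_one_of_one_le₀ (one_le_pow₀ hα)
  · ext n
    rcases n with _ | k
    · rw [sub_mul, map_sub, coeff_zero_X_mul, coeff_C_mul, coeff_mk, coeff_one, if_pos rfl,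
        zero_add, pow_one, mul_neg, mul_inv_cancel₀ hα0]
      ring
    · rw [sub_mul, map_sub, coeff_succ_X_mul, coeff_C_mul, coeff_mk, coeff_mk, coeff_one,
        if_neg (Nat.succ_ne_zero k)]
      field_simp
      ring

/-! ## §3 The vanishing at an interior root -/

/-- Values of equal series are equal (`HasSum` uniqueness transported along an equality of series).
[folklore] -/
theorem hasSum_unique_of_eq {F G : PowerSeries ℂ_[p]} (hFG : F = G) {y v w : ℂ_[p]}
    (hF : HasSum (fun n ↦ coeff n F * y ^ n) v) (hG : HasSum (fun n ↦ coeff n G * y ^ n) w) :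
    v = w := by
  subst hFG
  exact hF.unique hG

/-- **A bounded product `H = Ψ·P` vanishes at every root `α` of `P` in the open disc**, provided
`(1+T)·Ψ′ = a·Ψ`: with `P = (T−α)^μ P₁`, `P₁(α) ≠ 0`, `μ ≥ 1`, the identity
`(1+T)(T−α)P₁·H′ = H·(a(T−α)P₁ + (1+T)(μP₁ + (T−α)P₁′))` (from `(1+T)P H′ = H(aP + (1+T)P′)`
divided by `(T−α)^{μ−1}`) evaluated at `α` gives `0 = H(α)·(1+α)·μ·P₁(α)`.
[cite: Washington1997, §7.2] [cite: Cassels1986, Ch. 4] -/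
theorem hasSum_zero_of_ode_mul_polynomial {Ψ : PowerSeries ℂ_[p]} {a : ℂ_[p]}
    (hΨ : (1 + X) * d⁄dX ℂ_[p] Ψ = C a * Ψ) {P : Polynomial ℂ_[p]} (hP0 : P ≠ 0) {α : ℂ_[p]}
    (hα : ‖α‖ < 1) (hroot : P.IsRoot α) {B : ℝ}
    (hb : ∀ n, ‖coeff n (Ψ * (P : PowerSeries ℂ_[p]))‖ ≤ B) :
    HasSum (fun n ↦ coeff n (Ψ * (P : PowerSeries ℂ_[p])) * α ^ n) 0 := by
  -- `P = (T−α)^μ P₁`, `P₁(α) ≠ 0`, `μ ≥ 1`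
  obtain ⟨P₁, hP, hndvd⟩ := P.exists_eq_pow_rootMultiplicity_mul_and_not_dvd hP0 α
  set μ := P.rootMultiplicity α with hμ
  have hμpos : 0 < μ := (Polynomial.rootMultiplicity_pos hP0).mpr hroot
  have hP₁α : P₁.eval α ≠ 0 := by
    intro h; exact hndvd (Polynomial.dvd_iff_isRoot.mpr h)
  obtain ⟨ν, hν⟩ := Nat.exists_eq_add_of_lt hμpos
  rw [zero_add] at hν   -- `μ = ν + 1`
  set H := Ψ * (P : PowerSeries ℂ_[p]) with hHdef
  -- the identity `(1+T) P H' = H (aP + (1+T)P')` and its reduced form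
  set Lpoly : Polynomial ℂ_[p] := (1 + Polynomial.X) * (Polynomial.X - Polynomial.C α) * P₁ with hL
  set Rpoly : Polynomial ℂ_[p] := Polynomial.C a * (Polynomial.X - Polynomial.C α) * P₁ +
    (1 + Polynomial.X) * (Polynomial.C (μ : ℂ_[p]) * P₁ + (Polynomial.X - Polynomial.C α) *
      Polynomial.derivative P₁) with hR
  have hid : (Lpoly : PowerSeries ℂ_[p]) * d⁄dX ℂ_[p] H = H * (Rpoly : PowerSeries ℂ_[p]) := by
    -- `H' = Ψ' P + Ψ P'`
    have hH' : d⁄dX ℂ_[p] H = d⁄dX ℂ_[p] Ψ * (P : PowerSeries ℂ_[p]) +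
        Ψ * ((Polynomial.derivative P : Polynomial ℂ_[p]) : PowerSeries ℂ_[p]) := by
      rw [hHdef, Derivation.leibniz, smul_eq_mul, smul_eq_mul, derivative_coe]; ring
    -- `P' = (T−α)^ν ((ν+1) P₁ + (T−α) P₁')` as polynomials
    have hP' : Polynomial.derivative P = (Polynomial.X - Polynomial.C α) ^ ν *
        (Polynomial.C (μ : ℂ_[p]) * P₁ + (Polynomial.X - Polynomial.C α) *
          Polynomial.derivative P₁) := by
      rw [hP, hν, Polynomial.derivative_mul, Polynomial.derivative_pow,
        Polynomial.derivative_sub, Polynomial.derivative_X, Polynomial.derivative_C, sub_zero,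
        mul_one, Nat.add_sub_cancel, Nat.cast_add, Nat.cast_one, map_add, map_natCast, map_one]
      ring
    have hPc : (P : PowerSeries ℂ_[p]) =
        ((Polynomial.X - Polynomial.C α) ^ ν : Polynomial ℂ_[p]) *
          ((Polynomial.X - Polynomial.C α : Polynomial ℂ_[p]) * (P₁ : PowerSeries ℂ_[p])) := by
      conv_lhs => rw [hP, hν]
      rw [Polynomial.coe_mul, Polynomial.coe_pow, Polynomial.coe_pow, pow_succ]
      ring
    have hP'c : ((Polynomial.derivative P : Polynomial ℂ_[p]) : PowerSeries ℂ_[p]) =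
        ((Polynomial.X - Polynomial.C α) ^ ν : Polynomial ℂ_[p]) *
          ((Polynomial.C (μ : ℂ_[p]) * P₁ + (Polynomial.X - Polynomial.C α) *
            Polynomial.derivative P₁ : Polynomial ℂ_[p]) : PowerSeries ℂ_[p]) := by
      rw [hP', Polynomial.coe_mul]
    -- cancel `(T−α)^ν`
    have hRν : (((Polynomial.X - Polynomial.C α) ^ ν : Polynomial ℂ_[p]) : PowerSeries ℂ_[p]) ≠ 0 := by
      rw [Ne, Polynomial.coe_eq_zero_iff]
      exact pow_ne_zero _ (Polynomial.X_sub_C_ne_zero α)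
    apply mul_left_cancel₀ hRν
    have h1X : ((1 + Polynomial.X : Polynomial ℂ_[p]) : PowerSeries ℂ_[p]) = 1 + X := by
      rw [Polynomial.coe_add, Polynomial.coe_one, Polynomial.coe_X]
    -- both sides in terms of `Ψ`
    calc (((Polynomial.X - Polynomial.C α) ^ ν : Polynomial ℂ_[p]) : PowerSeries ℂ_[p]) *
          ((Lpoly : PowerSeries ℂ_[p]) * d⁄dX ℂ_[p] H)
        = (1 + X) * (P : PowerSeries ℂ_[p]) * (d⁄dX ℂ_[p] Ψ * (P : PowerSeries ℂ_[p]) +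
            Ψ * ((Polynomial.derivative P : Polynomial ℂ_[p]) : PowerSeries ℂ_[p])) := by
          rw [hH', hL, Polynomial.coe_mul, Polynomial.coe_mul, h1X, hPc]; ring
      _ = (P : PowerSeries ℂ_[p]) * ((1 + X) * d⁄dX ℂ_[p] Ψ) * (P : PowerSeries ℂ_[p]) +
            (1 + X) * (P : PowerSeries ℂ_[p]) * Ψ *
              ((Polynomial.derivative P : Polynomial ℂ_[p]) : PowerSeries ℂ_[p]) := by
          ring
      _ = (P : PowerSeries ℂ_[p]) * (C a * Ψ) * (P : PowerSeries ℂ_[p]) +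
            (1 + X) * (P : PowerSeries ℂ_[p]) * Ψ *
              ((Polynomial.derivative P : Polynomial ℂ_[p]) : PowerSeries ℂ_[p]) := by
          rw [hΨ]
      _ = (((Polynomial.X - Polynomial.C α) ^ ν : Polynomial ℂ_[p]) : PowerSeries ℂ_[p]) *
          (H * (Rpoly : PowerSeries ℂ_[p])) := by
          rw [hHdef, hP'c, hPc, hR]
          push_cast
          ring
  -- bounds and values
  obtain ⟨BL, hBL⟩ := exists_norm_coeff_coe_le Lpoly
  obtain ⟨BR, hBR⟩ := exists_norm_coeff_coe_le Rpoly
  have hH'b := norm_coeff_derivative_le hb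
  have hvL := hasSum_coeff_mul hBL hH'b hα          -- value of `Lpoly * H'`
  have hvR := hasSum_coeff_mul hb hBR hα            -- value of `H * Rpoly`
  rw [(hasSum_coeff_coe_polynomial Lpoly α).tsum_eq] at hvL
  rw [(hasSum_coeff_coe_polynomial Rpoly α).tsum_eq] at hvR
  have heq := hasSum_unique_of_eq hid hvL hvR
  -- `Lpoly(α) = 0`, `Rpoly(α) = (1+α) μ P₁(α) ≠ 0`
  have hLα : Lpoly.eval α = 0 := by simp [hL]
  have hRα : Rpoly.eval α = (1 + α) * ((μ : ℂ_[p]) * P₁.eval α) := by simp [hR]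
  have h1α : (1 : ℂ_[p]) + α ≠ 0 := by
    intro h
    have : ‖α‖ = 1 := by
      rw [show α = -1 from by linear_combination h, norm_neg, norm_one]
    exact absurd this hα.ne
  have hμ0 : (μ : ℂ_[p]) ≠ 0 := by exact_mod_cast hμpos.ne'
  have hRα0 : Rpoly.eval α ≠ 0 := by
    rw [hRα]; exact mul_ne_zero h1α (mul_ne_zero hμ0 hP₁α)
  rw [hLα, zero_mul] at heq
  -- so `H(α) = 0`
  have hval : (∑' n, coeff n H * α ^ n) = 0 := by
    have := heq.symm
    rwa [mul_eq_zero, or_iff_left hRα0] at this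
  rw [← hval]
  exact hasSum_coeff hb hα

/-! ## §4 The peeling induction -/

/-- **Root peeling.** If `Ψ ∈ ℂ_p⟦T⟧` satisfies `(1+T)·Ψ′ = a·Ψ` and `Ψ·P` has bounded coefficients
for some polynomial `P ≠ 0`, then `Ψ` has bounded coefficients. Induction on `deg P`: a constant
`P` is trivial; otherwise pick a root `α` (`ℂ_p` is algebraically closed) and write `P = (T−α)·P₂`;
if `‖α‖ ≥ 1` then `Ψ·P₂ = (Ψ·P)·(T−α)⁻¹` is bounded; if `‖α‖ < 1` then `Ψ·P` vanishes at `α` (§3),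
so `Ψ·P = (T−α)·H₁` with `H₁` bounded (§2) and `Ψ·P₂ = H₁`. [cite: Washington1997, §7.2]
[cite: Cassels1986, Ch. 6 §5] -/
theorem exists_norm_coeff_le_of_ode_of_mul_polynomial {Ψ : PowerSeries ℂ_[p]} {a : ℂ_[p]}
    (hΨ : (1 + X) * d⁄dX ℂ_[p] Ψ = C a * Ψ) :
    ∀ (P : Polynomial ℂ_[p]), P ≠ 0 → (∃ B : ℝ, ∀ n, ‖coeff n (Ψ * (P : PowerSeries ℂ_[p]))‖ ≤ B) →
      ∃ B' : ℝ, ∀ n, ‖coeff n Ψ‖ ≤ B' := by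
  intro P
  induction hd : P.natDegree using Nat.strong_induction_on generalizing P with
  | _ d ih =>
    intro hP0 hb
    obtain ⟨B, hB⟩ := hb
    have hBnn : 0 ≤ B := (norm_nonneg _).trans (hB 0)
    by_cases hdeg : P.natDegree = 0
    · -- constant polynomial
      have hPC : P = Polynomial.C (P.coeff 0) := Polynomial.eq_C_of_natDegree_eq_zero hdeg
      have hc0 : P.coeff 0 ≠ 0 := by
        intro h; apply hP0; rw [hPC, h, map_zero]
      refine ⟨B * ‖P.coeff 0‖⁻¹, fun n ↦ ?_⟩
      have := hB n
      rw [hPC, Polynomial.coe_C, mul_comm, coeff_C_mul, norm_mul] at this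
      rw [le_mul_inv_iff₀ (norm_pos_iff.mpr hc0), mul_comm]
      exact this
    · -- a root `α`, `P = (T−α) P₂`
      have hdeg' : P.degree ≠ 0 := by
        intro h; exact hdeg (Polynomial.natDegree_eq_of_degree_eq_some h)
      obtain ⟨α, hα⟩ := IsAlgClosed.exists_root P hdeg'
      set P₂ := P /ₘ (Polynomial.X - Polynomial.C α) with hP₂
      have hPfac : (Polynomial.X - Polynomial.C α) * P₂ = P :=
        Polynomial.mul_divByMonic_eq_iff_isRoot.mpr hα
      have hP₂0 : P₂ ≠ 0 := by
        intro h; apply hP0; rw [← hPfac, h, mul_zero]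
      have hP₂deg : P₂.natDegree < d := by
        rw [hP₂, Polynomial.natDegree_divByMonic _ (Polynomial.monic_X_sub_C α),
          Polynomial.natDegree_X_sub_C, hd]
        omega
      have hcoe : (P : PowerSeries ℂ_[p]) = (X - C α) * (P₂ : PowerSeries ℂ_[p]) := by
        rw [← hPfac, Polynomial.coe_mul, Polynomial.coe_sub, Polynomial.coe_X, Polynomial.coe_C]
      -- it suffices to bound `Ψ * P₂`
      suffices hb₂ : ∃ B₂ : ℝ, ∀ n, ‖coeff n (Ψ * (P₂ : PowerSeries ℂ_[p]))‖ ≤ B₂ from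
        ih P₂.natDegree hP₂deg P₂ rfl hP₂0 hb₂
      by_cases hα1 : ‖α‖ < 1
      · -- interior root: `Ψ P` vanishes at `α`
        have h0 := hasSum_zero_of_ode_mul_polynomial hΨ hP0 hα1 hα hB
        obtain ⟨H₁, hH₁b, hH₁⟩ := exists_eq_X_sub_C_mul_of_hasSum_zero hB hα1 h0
        refine ⟨B, fun n ↦ ?_⟩
        have hXα : (X - C α : PowerSeries ℂ_[p]) ≠ 0 := by
          rw [← Polynomial.coe_X, ← Polynomial.coe_C, ← Polynomial.coe_sub, Ne,
            Polynomial.coe_eq_zero_iff]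
          exact Polynomial.X_sub_C_ne_zero α
        have hcancel : Ψ * (P₂ : PowerSeries ℂ_[p]) = H₁ := by
          apply mul_left_cancel₀ hXα
          rw [← hH₁, hcoe]; ring
        rw [hcancel]; exact hH₁b n
      · -- exterior root: invert `T − α`
        obtain ⟨G, hGb, hG⟩ := exists_X_sub_C_mul_eq_one_of_one_le_norm (not_lt.mp hα1)
        refine ⟨B * 1, fun n ↦ ?_⟩
        have hcancel : Ψ * (P₂ : PowerSeries ℂ_[p]) = Ψ * (P : PowerSeries ℂ_[p]) * G := by
          rw [hcoe]
          calc Ψ * (P₂ : PowerSeries ℂ_[p]) = Ψ * (P₂ : PowerSeries ℂ_[p]) * ((X - C α) * G) := by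
                rw [hG, mul_one]
            _ = Ψ * ((X - C α) * (P₂ : PowerSeries ℂ_[p])) * G := by ring
        rw [hcancel]
        exact norm_coeff_mul_le hB hGb n

end Summit.BirchSwinnertonDyer.BirchSwinnertonDyer.Theorems.KatzLineDescent

end
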